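import Literature.AlgebraicTopology.Homotopy.SequenceTelescopeHausdorff
import Literature.AlgebraicTopology.Homotopy.CubeHomotopyExtension
import Literature.AlgebraicTopology.Homotopy.WeakHomotopyEquivalence
import HarnessLib

/-!
# Homotopy groups of a mapping telescope: `πₖ T(f) = colim πₖ Xₙ` by compactness

Topic `Literature/AlgebraicTopology/Homotopy` (sub-namespace `SeqTelescope`, continuing
`SequenceTelescope.lean` / `SequenceTelescopeHausdorff.lean`). For the mapping telescope
`T = T(f₀, f₁, …)` of a sequence `X₀ → X₁ → ⋯` (Hatcher, *Algebraic Topology* (2002), §3.F,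
p. 312) the homotopy groups are the colimit of those of the `Xₙ`: a compact subset of `T` has
bounded height, the part of `T` of height `≤ J` flows forward onto the level `X_J × {0}` by a
deformation of `T` homotopic to the identity, and maps into that level are maps into `X_J`
(Hatcher 2002, proof of Prop. 4.13/Ex. 4.15 and §4.1 p. 354, the step "any map of a compact set
meets only finitely many stages"; p. 312, "the natural maps `Xᵢ → T` induce `colim → ` an
isomorphism on homology/homotopy by compactness"). This file PROVES the three consequences that
the killing-homotopy-groups construction (`PostnikovSection.lean`) consumes, all at the level of
Mathlib's cubical `GenLoop`/`HomotopyGroup` and phrased to avoid transporting base points: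

* `SeqTelescope.lvl f n : C(X n, T)` (`x ↦ (n, x, 0)`), `SeqTelescope.through f n : C(X 0, X n)`
  (the composite `f_{n-1} ∘ ⋯ ∘ f₀`); the forward deformation `SeqTelescope.retractTo f J`
  (`J` steps of "advance by `min(1, J - height)`", `SequenceTelescope.adv`) with its homotopy
  `SeqTelescope.retractHomotopy f J` from the identity, landing in level `J` on heights `≤ J`
  (`height_retractTo`, `retractTo_lvl_zero`: `(0, x, 0) ↦ (J, through J x, 0)`);
* `SeqTelescope.surjective_homotopyGroupMap_lvl_zero` — if each `(fₙ)_*` is onto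
  `πₖ` at the base points `through n x₀`, then `(lvl 0)_* : πₖ(X₀, x₀) → πₖ(T, (0, x₀, 0))` is onto;
* `SeqTelescope.injective_homotopyGroupMap_lvl_zero` — the same with "injective";
* `SeqTelescope.subsingleton_homotopyGroup` — if `πₖ(Xₙ, x) = 0` for all `n ≥ n₀` and all `x`,
  then `πₖ(T, b) = 0` at every point `b` of the telescope.

The mechanism of all three (Hatcher 2002, §4.1 p. 341, change of base point along the track of a
free homotopy) is the tree's `CubeHEP.homotopicRel_of_homotopies`: the deformation `Rₛ` gives free
homotopies `r ∼ R ∘ r` and `v ∼ R ∘ v` with the SAME boundary track `s ↦ Rₛ(b)`, and `R ∘ r`,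
`R ∘ v` are compared rel `∂Iᵏ` inside the level `X_J`.

## References

* A. Hatcher, *Algebraic Topology*, CUP (2002), §3.F p. 312 (mapping telescope), §4.1 p. 341
  (change of basepoint), p. 354 (Postnikov towers: compactness). [HatcherAT2002]
-/

noncomputable section

open Set Function Topology unitInterval ContinuousMap
open scoped Topology.Homotopy

universe u

namespace Literature.AlgebraicTopology.Homotopy

namespace SeqTelescope

variable {X : ℕ → Type u} [∀ n, TopologicalSpace (X n)] (f : ∀ n, C(X n, X (n + 1)))

/-! ### Levels and composites -/

/-- The level inclusion `x ↦ (n, x, 0)`. [cite: HatcherAT2002, §3.F p. 312] -/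
def lvl (n : ℕ) : C(X n, SeqTelescope f) :=
  ⟨fun x => mk f n x 0, continuous_mk_comp f n continuous_id continuous_const⟩

/-- `lvl` on points. [folklore] -/
@[simp] theorem lvl_apply (n : ℕ) (x : X n) : lvl f n x = mk f n x 0 := rfl

/-- The composite `f_{n-1} ∘ ⋯ ∘ f₀ : X 0 → X n`. [folklore] -/
def through : ∀ n, C(X 0, X n)
  | 0 => ContinuousMap.id _
  | n + 1 => (f n).comp (through n)

/-- `through 0 = id`. [folklore] -/
@[simp] theorem through_zero (x : X 0) : through f 0 x = x := rfl

/-- `through (n+1) = fₙ ∘ through n`. [folklore] -/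
@[simp] theorem through_succ (n : ℕ) (x : X 0) : through f (n + 1) x = f n (through f n x) := rfl

/-! ### Height bookkeeping -/

/-- Every point is `(n, x, t)` with `t < 1`. [folklore] -/
theorem exists_eq_mk_lt_one (z : SeqTelescope f) : ∃ (n : ℕ) (x : X n) (t : I), (t : ℝ) < 1 ∧ z = mk f n x t := by
  induction z using ind with
  | h n x t =>
    by_cases ht : (t : ℝ) < 1
    · exact ⟨n, x, t, ht, rfl⟩
    · have h1 : t = 1 := Subtype.ext (le_antisymm t.2.2 (not_lt.1 ht))
      exact ⟨n + 1, f n x, 0, by norm_num, by rw [h1, mk_one]⟩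

/-- The height is nonnegative. [folklore] -/
theorem height_nonneg (z : SeqTelescope f) : 0 ≤ height f z := by
  induction z using ind with
  | h n x t => rw [height_mk]; exact add_nonneg (Nat.cast_nonneg n) t.2.1

/-- A point of integer height `J` is the bottom `(J, x, 0)` of level `J`. [folklore] -/
theorem exists_eq_lvl_of_height_eq {z : SeqTelescope f} {J : ℕ} (h : height f z = J) :
    ∃ x : X J, z = lvl f J x := by
  obtain ⟨n, x, t, ht, rfl⟩ := exists_eq_mk_lt_one f z
  rw [height_mk] at h
  obtain ⟨rfl, ht0⟩ := eq_of_height_eq (n := n) (n' := J) (t := t) (t' := 0) ht (by norm_num) (by simpa using h)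
  exact ⟨x, by rw [ht0]; rfl⟩

/-- Advancing raises the height by `δ`. [folklore] -/
theorem height_adv (z : SeqTelescope f) (δ : I) : height f (adv f (z, δ)) = height f z + δ := by
  induction z using ind with
  | h n x t =>
    rw [adv_mk, advAux, height_mk]
    split_ifs with h
    · rw [height_mk, coe_clampI, max_eq_right (le_min zero_le_one (add_nonneg t.2.1 δ.2.1)), min_eq_right h]
      ring
    · rw [height_mk, coe_clampI]
      have h1 : (t : ℝ) + δ - 1 ≤ 1 := by linarith [t.2.2, δ.2.2]
      have h2 : 0 ≤ (t : ℝ) + δ - 1 := by linarith [not_le.1 h]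
      rw [max_eq_right (le_min zero_le_one h2), min_eq_right h1]
      push_cast; ring

/-! ### The forward deformation onto level `J` -/

/-- The advance parameter `min(1, max(0, J - height))`. [folklore] -/
def deltaTo (J : ℕ) : C(SeqTelescope f, I) :=
  ⟨fun z => clampI ((J : ℝ) - height f z), continuous_clampI.comp (continuous_const.sub (height f).continuous)⟩

/-- `deltaTo J` as a real number. [folklore] -/
theorem coe_deltaTo (J : ℕ) (z : SeqTelescope f) :
    (deltaTo f J z : ℝ) = max 0 (min 1 ((J : ℝ) - height f z)) := coe_clampI _

/-- One step: advance by `deltaTo J`. [folklore] -/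
def stepTo (J : ℕ) : C(SeqTelescope f, SeqTelescope f) := advBy f (deltaTo f J)

/-- The height after one step is `min (height + 1) (max height J)`. [folklore] -/
theorem height_stepTo (J : ℕ) (z : SeqTelescope f) :
    height f (stepTo f J z) = height f z + max 0 (min 1 ((J : ℝ) - height f z)) := by
  rw [stepTo, advBy_apply, height_adv, coe_deltaTo]

/-- `J`-fold iteration of the step. [folklore] -/
def retractTo (J : ℕ) : ℕ → C(SeqTelescope f, SeqTelescope f)
  | 0 => ContinuousMap.id _
  | i + 1 => (stepTo f J).comp (retractTo J i)

/-- `retractTo J 0 = id`. [folklore] -/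
@[simp] theorem retractTo_zero (J : ℕ) (z : SeqTelescope f) : retractTo f J 0 z = z := rfl

/-- `retractTo J (i+1) = stepTo J ∘ retractTo J i`. [folklore] -/
@[simp] theorem retractTo_succ (J i : ℕ) (z : SeqTelescope f) :
    retractTo f J (i + 1) z = stepTo f J (retractTo f J i z) := rfl

/-- After `i` steps a point of height `h ≤ J` has height `min (h + i) J`. [folklore] -/
theorem height_retractTo_of_le (J : ℕ) {z : SeqTelescope f} (hz : height f z ≤ J) (i : ℕ) :
    height f (retractTo f J i z) = min (height f z + i) J := by
  induction i with
  | zero => simp [min_eq_left hz]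
  | succ i ih =>
    rw [retractTo_succ, height_stepTo, ih]
    have h0 := height_nonneg f z
    by_cases h : height f z + i ≤ J
    · rw [min_eq_left h]
      by_cases h' : height f z + i + 1 ≤ J
      · rw [min_eq_left (by linarith : (1 : ℝ) ≤ J - (height f z + i)), max_eq_right zero_le_one]
        push_cast; rw [min_eq_left (by linarith)]; ring
      · rw [min_eq_right (by linarith : (J : ℝ) - (height f z + i) ≤ 1), max_eq_right (by linarith)]
        push_cast; rw [min_eq_right (by linarith)]; ring
    · rw [min_eq_right (not_le.1 h).le, sub_self, min_eq_right zero_le_one, max_self, add_zero]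
      push_cast; rw [min_eq_right (by linarith [not_le.1 h])]

/-- **The deformation lands in level `J`** on points of height `≤ J`. [folklore] -/
theorem height_retractTo (J : ℕ) {z : SeqTelescope f} (hz : height f z ≤ J) :
    height f (retractTo f J J z) = J := by
  rw [height_retractTo_of_le f J hz, min_eq_right]
  linarith [height_nonneg f z]

/-- The step moves a level bottom `(i, y, 0)`, `i < J`, to `(i + 1, fᵢ y, 0)`. [folklore] -/
theorem stepTo_lvl_of_lt {J i : ℕ} (hi : i < J) (y : X i) : stepTo f J (lvl f i y) = lvl f (i + 1) (f i y) := by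
  have hδ : deltaTo f J (lvl f i y) = 1 := by
    apply Subtype.ext
    rw [coe_deltaTo, lvl_apply, height_mk, Icc.coe_one]
    have : (1 : ℝ) ≤ J - (i + (0 : I)) := by
      have hi' : (i : ℝ) + 1 ≤ J := by exact_mod_cast hi
      simp only [Icc.coe_zero, add_zero]; linarith
    rw [min_eq_left this, max_eq_right zero_le_one]
  rw [stepTo, advBy_apply, hδ, lvl_apply, adv_one]; rfl

/-- The step fixes points of height `≥ J`. [folklore] -/
theorem stepTo_of_le {J : ℕ} {z : SeqTelescope f} (hz : (J : ℝ) ≤ height f z) : stepTo f J z = z := by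
  have hδ : deltaTo f J z = 0 := by
    apply Subtype.ext
    rw [coe_deltaTo, Icc.coe_zero, max_eq_left]
    exact min_le_of_right_le (by linarith)
  rw [stepTo, advBy_apply, hδ, adv_zero]

/-- **The deformation on level `0`**: `(0, x, 0) ↦ (J, through J x, 0)`. [folklore] -/
theorem retractTo_lvl_zero (J : ℕ) (x : X 0) : retractTo f J J (lvl f 0 x) = lvl f J (through f J x) := by
  have key : ∀ i, i ≤ J → retractTo f J i (lvl f 0 x) = lvl f i (through f i x) := by
    intro i
    induction i with
    | zero => intro; rfl
    | succ i ih =>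
      intro hi
      rw [retractTo_succ, ih (Nat.le_of_succ_le hi), stepTo_lvl_of_lt f hi]; rfl
  exact key J le_rfl

/-- **The deformation is homotopic to the identity**, by iterating `homotopyIdAdvBy`.
[folklore] -/
def retractHomotopy (J : ℕ) : ∀ i, (ContinuousMap.id (SeqTelescope f)).Homotopy (retractTo f J i)
  | 0 => ContinuousMap.Homotopy.refl _
  | i + 1 => (homotopyIdAdvBy f (deltaTo f J)).comp (retractHomotopy J i)

/-! ### Maps into a level are maps into `X_J` -/

section Level

variable {f}

/-- A continuous map into the telescope with values of height exactly `J` factors continuously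
through level `J`. [folklore] -/
theorem exists_factor_lvl {W : Type*} [TopologicalSpace W] (g : C(W, SeqTelescope f)) {J : ℕ}
    (hg : ∀ w, height f (g w) = J) (x₀ : X J) :
    ∃ g' : C(W, X J), ∀ w, lvl f J (g' w) = g w := by
  have hmem : ∀ w, g w ∈ slab f J := fun w => by
    show height f (g w) ∈ Ioo ((J : ℝ) - 1 / 2) (J + 1)
    rw [hg w]; constructor <;> linarith
  refine ⟨⟨fun w => levelCoord f J x₀ (g w), (continuousOn_levelCoord f J x₀).comp_continuous g.continuous hmem⟩,
    fun w => ?_⟩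
  obtain ⟨x, hx⟩ := exists_eq_lvl_of_height_eq f (hg w)
  show lvl f J (levelCoord f J x₀ (g w)) = g w
  rw [hx]
  show mk f J (levelCoord f J x₀ (mk f J x 0)) 0 = mk f J x 0
  rw [levelCoord_mk_of_lt_one f J x₀ x (by norm_num)]

/-- `lvl J` is injective. [folklore] -/
theorem lvl_injective (J : ℕ) : Injective (lvl f J) := fun _ _ h => (mk_zero_eq_mk_zero_iff f).1 h

end Level

/-! ### A height bound for compact images -/

/-- A continuous map from a compact space into the telescope has bounded height. [folklore] -/
theorem exists_height_le {W : Type*} [TopologicalSpace W] [CompactSpace W] (g : C(W, SeqTelescope f)) :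
    ∃ J : ℕ, ∀ w, height f (g w) ≤ J := by
  obtain ⟨B, hB⟩ := (isCompact_range ((height f).continuous.comp g.continuous)).isBounded.subset_closedBall 0
  refine ⟨⌈B⌉₊, fun w => ?_⟩
  have h := hB (mem_range_self w)
  rw [Metric.mem_closedBall, dist_zero_right, Real.norm_eq_abs, abs_le] at h
  exact h.2.trans (Nat.le_ceil B)

/-! ### Homotopy groups: the three transfers -/

section Transfer

variable {f}
variable {N : Type*} [Fintype N]

omit [Fintype N] in
/-- Pulling a homotopy rel `∂Iᴺ` inside level `J` back to `X_J`. [folklore] -/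
theorem homotopicRel_of_lvl_comp {J : ℕ} {u v : C(N → I, X J)}
    (K : ((lvl f J).comp u).HomotopyRel ((lvl f J).comp v) (Cube.boundary N))
    (himg : ∀ p, height f (K p) = J) :
    u.HomotopicRel v (Cube.boundary N) := by
  obtain ⟨x₀⟩ : Nonempty (X J) := ⟨u (fun _ => 0)⟩
  obtain ⟨K', hK'⟩ := exists_factor_lvl K.toContinuousMap himg x₀
  have hinj := lvl_injective (f := f) J
  refine ⟨{ toContinuousMap := K'
            map_zero_left := fun y => hinj ?_
            map_one_left := fun y => hinj ?_
            prop' := fun t y hy => hinj ?_ }⟩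
  · show lvl f J (K' (0, y)) = lvl f J (u y)
    rw [hK']; exact K.apply_zero y
  · show lvl f J (K' (1, y)) = lvl f J (v y)
    rw [hK']; exact K.apply_one y
  · show lvl f J (K' (t, y)) = lvl f J (u y)
    rw [hK']; exact K.prop' t y hy

/-- **Surjectivity passes to the telescope.** If every `(fₙ)_* : πₖ(Xₙ, through n x₀) →
πₖ(Xₙ₊₁, through (n+1) x₀)` is onto, then so is `(lvl 0)_* : πₖ(X₀, x₀) → πₖ(T, (0, x₀, 0))`.
[cite: HatcherAT2002, §4.1 p. 354; §3.F p. 312] -/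
theorem surjective_homotopyGroupMap_lvl_zero (x₀ : X 0)
    (hs : ∀ n, Surjective (homotopyGroupMap (N := N) (f n) (through f n x₀))) :
    Surjective (homotopyGroupMap (N := N) (lvl f 0) x₀) := by
  -- surjectivity of the composites
  have hS : ∀ n, Surjective (homotopyGroupMap (N := N) (through f n) x₀) := by
    intro n
    induction n with
    | zero => rw [show through f 0 = ContinuousMap.id _ from rfl, homotopyGroupMap_id]; exact surjective_id
    | succ n ih => rw [show through f (n + 1) = (f n).comp (through f n) from rfl, homotopyGroupMap_comp]; exact (hs n).comp ih
  intro c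
  induction c using Quotient.inductionOn with
  | h r => ?_
  -- a height bound and the deformation
  obtain ⟨J, hJ⟩ := exists_height_le f (r : C(N → I, SeqTelescope f))
  set R := retractTo f J J with hR
  set H := retractHomotopy f J J with hH
  have hRb : R (lvl f 0 x₀) = lvl f J (through f J x₀) := retractTo_lvl_zero f J x₀
  -- `R ∘ r` is a loop in level `J`
  have hRr : ∀ y, height f (R (r y)) = J := fun y => height_retractTo f J (hJ y)
  obtain ⟨r', hr'⟩ := exists_factor_lvl (R.comp (r : C(N → I, SeqTelescope f))) (fun y => hRr y) (through f J x₀)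
  have hr'b : ∀ y ∈ Cube.boundary N, r' y = through f J x₀ := fun y hy => lvl_injective J (by
    rw [hr', ContinuousMap.comp_apply]; erw [r.2 y hy]; exact hRb)
  let rJ : Ω^ N (X J) (through f J x₀) := ⟨r', hr'b⟩
  -- it comes from `X 0`
  obtain ⟨cq, hcq⟩ := hS J ⟦rJ⟧
  induction cq using Quotient.inductionOn with
  | h q => ?_
  refine ⟨⟦q⟧, ?_⟩
  rw [homotopyGroupMap_mk] at hcq ⊢
  apply Quotient.sound
  have hG0 : GenLoop.Homotopic (genLoopMap (through f J) x₀ q) rJ := Quotient.exact hcq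
  -- push the homotopy rel `∂` into the telescope: `R ∘ r ≃ R ∘ (lvl 0 ∘ q)` rel `∂`
  obtain ⟨G⟩ := hG0.symm
  have e₁ : (lvl f J).comp (rJ : C(N → I, X J)) = R.comp (r : C(N → I, SeqTelescope f)) := by
    ext y; exact hr' y
  have e₂ : (lvl f J).comp (genLoopMap (through f J) x₀ q : C(N → I, X J)) =
      R.comp ((lvl f 0).comp (q : C(N → I, X 0))) := by
    ext y
    show lvl f J (through f J (q y)) = R (lvl f 0 (q y))
    rw [hR, retractTo_lvl_zero]
  let G' : (R.comp (r : C(N → I, SeqTelescope f))).HomotopyRel (R.comp ((lvl f 0).comp (q : C(N → I, X 0))))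
      (Cube.boundary N) := (G.compContinuousMap (lvl f J)).cast e₁ e₂
  -- the two free homotopies along `H`, with the same boundary track
  let A : (R.comp (r : C(N → I, SeqTelescope f))).Homotopy (r : C(N → I, SeqTelescope f)) :=
    (H.compContinuousMap (r : C(N → I, SeqTelescope f))).symm
  let C : (R.comp ((lvl f 0).comp (q : C(N → I, X 0)))).Homotopy ((lvl f 0).comp (q : C(N → I, X 0))) :=
    (H.compContinuousMap ((lvl f 0).comp (q : C(N → I, X 0)))).symm
  have hAC : ∀ (s : I), ∀ y ∈ Cube.boundary N, A (s, y) = C (s, y) := by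
    intro s y hy
    show H (σ s, r y) = H (σ s, lvl f 0 (q y))
    erw [r.2 y hy, q.2 y hy]
  have key := CubeHEP.homotopicRel_of_homotopies A G' C hAC
  exact key.symm

omit [Fintype N] in
/-- **Injectivity passes to the telescope.** If every `(fₙ)_*` is injective on `πₖ` at the base
points `through n x₀`, then so is `(lvl 0)_* : πₖ(X₀, x₀) → πₖ(T, (0, x₀, 0))`.
[cite: HatcherAT2002, §4.1 p. 354; §3.F p. 312] -/
theorem injective_homotopyGroupMap_lvl_zero (x₀ : X 0)
    (hi : ∀ n, Injective (homotopyGroupMap (N := N) (f n) (through f n x₀))) :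
    Injective (homotopyGroupMap (N := N) (lvl f 0) x₀) := by
  have hI : ∀ n, Injective (homotopyGroupMap (N := N) (through f n) x₀) := by
    intro n
    induction n with
    | zero => rw [show through f 0 = ContinuousMap.id _ from rfl, homotopyGroupMap_id]; exact injective_id
    | succ n ih => rw [show through f (n + 1) = (f n).comp (through f n) from rfl, homotopyGroupMap_comp]; exact (hi n).comp ih
  intro c₁ c₂
  induction c₁ using Quotient.inductionOn with
  | h q₁ => ?_
  induction c₂ using Quotient.inductionOn with
  | h q₂ => ?_
  intro h
  rw [homotopyGroupMap_mk, homotopyGroupMap_mk] at h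
  obtain ⟨K⟩ : GenLoop.Homotopic (genLoopMap (lvl f 0) x₀ q₁) (genLoopMap (lvl f 0) x₀ q₂) := Quotient.exact h
  -- a height bound for the homotopy and the deformation
  obtain ⟨J, hJ⟩ := exists_height_le f K.toContinuousMap
  set R := retractTo f J J with hR
  -- `R ∘ K` is a homotopy rel `∂` inside level `J` between `lvl J ∘ through J ∘ qᵢ`
  have e : ∀ q : Ω^ N (X 0) x₀, R.comp (genLoopMap (lvl f 0) x₀ q : C(N → I, SeqTelescope f)) =
      (lvl f J).comp (genLoopMap (through f J) x₀ q : C(N → I, X J)) := fun q => by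
    ext y
    show R (lvl f 0 (q y)) = lvl f J (through f J (q y))
    rw [hR, retractTo_lvl_zero]
  let K' := (K.compContinuousMap R).cast (e q₁) (e q₂)
  have hK : (genLoopMap (through f J) x₀ q₁ : C(N → I, X J)).HomotopicRel
      (genLoopMap (through f J) x₀ q₂ : C(N → I, X J)) (Cube.boundary N) :=
    homotopicRel_of_lvl_comp K' fun p => height_retractTo f J (hJ p)
  exact (hI J) (Quotient.sound hK)

/-- **Vanishing passes to the telescope, at every base point.** If `πₖ(Xₙ, x) = 0` for all
`n ≥ n₀` and all `x ∈ Xₙ`, then `πₖ(T, b) = 0` for every point `b` of the telescope: a loop `r`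
at `b` is deformed by `Rₛ` into level `J ≥ n₀`, where it is null rel `∂Iᵏ`; the constant loop at
`b` is deformed by the same `Rₛ` with the same boundary track. [cite: HatcherAT2002, §4.1 p. 354; §3.F p. 312] -/
theorem subsingleton_homotopyGroup {n₀ : ℕ}
    (h0 : ∀ n, n₀ ≤ n → ∀ x : X n, Subsingleton (HomotopyGroup N (X n) x)) (b : SeqTelescope f) :
    Subsingleton (HomotopyGroup N (SeqTelescope f) b) := by
  classical
  refine ⟨fun c₁ c₂ => ?_⟩
  suffices hall : ∀ c : HomotopyGroup N (SeqTelescope f) b, c = ⟦GenLoop.const⟧ by rw [hall c₁, hall c₂]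
  intro c
  induction c using Quotient.inductionOn with
  | h r => ?_
  apply Quotient.sound
  -- a height bound (for the loop, the base point and `n₀`) and the deformation
  obtain ⟨J₁, hJ₁⟩ := exists_height_le f (r : C(N → I, SeqTelescope f))
  obtain ⟨J, hJr, hJb, hJn⟩ : ∃ J : ℕ, (∀ y, height f (r y) ≤ J) ∧ height f b ≤ J ∧ n₀ ≤ J := by
    refine ⟨max J₁ (max ⌈height f b⌉₊ n₀), fun y => (hJ₁ y).trans (by exact_mod_cast le_max_left _ _), ?_,
      le_trans (le_max_right _ _) (le_max_right _ _)⟩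
    exact (Nat.le_ceil _).trans (by exact_mod_cast le_trans (le_max_left _ _) (le_max_right _ _))
  set R := retractTo f J J with hR
  set H := retractHomotopy f J J with hH
  -- `R b` and `R ∘ r` in level `J`
  obtain ⟨xb, hxb⟩ := exists_eq_lvl_of_height_eq f (height_retractTo f J hJb)
  obtain ⟨r', hr'⟩ := exists_factor_lvl (R.comp (r : C(N → I, SeqTelescope f)))
    (fun y => height_retractTo f J (hJr y)) xb
  have hr'b : ∀ y ∈ Cube.boundary N, r' y = xb := fun y hy => lvl_injective J (by
    rw [hr', ContinuousMap.comp_apply, ← hxb]; erw [r.2 y hy])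
  let rJ : Ω^ N (X J) xb := ⟨r', hr'b⟩
  -- it is null in `X J`
  have hnull : GenLoop.Homotopic rJ GenLoop.const :=
    Quotient.exact (@Subsingleton.elim (HomotopyGroup N (X J) xb) (h0 J hJn xb) ⟦rJ⟧ ⟦GenLoop.const⟧)
  obtain ⟨G⟩ := hnull
  have e₁ : (lvl f J).comp (rJ : C(N → I, X J)) = R.comp (r : C(N → I, SeqTelescope f)) := by
    ext y; exact hr' y
  have e₂ : (lvl f J).comp ((GenLoop.const : Ω^ N (X J) xb) : C(N → I, X J)) =
      R.comp (ContinuousMap.const (N → I) b) := by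
    ext y; exact hxb.symm
  let G' : (R.comp (r : C(N → I, SeqTelescope f))).HomotopyRel (R.comp (ContinuousMap.const (N → I) b))
      (Cube.boundary N) := (G.compContinuousMap (lvl f J)).cast e₁ e₂
  let A : (R.comp (r : C(N → I, SeqTelescope f))).Homotopy (r : C(N → I, SeqTelescope f)) :=
    (H.compContinuousMap (r : C(N → I, SeqTelescope f))).symm
  let C : (R.comp (ContinuousMap.const (N → I) b)).Homotopy (ContinuousMap.const (N → I) b) :=
    (H.compContinuousMap (ContinuousMap.const (N → I) b)).symm
  have hAC : ∀ (s : I), ∀ y ∈ Cube.boundary N, A (s, y) = C (s, y) := by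
    intro s y hy
    show H (σ s, r y) = H (σ s, b)
    erw [r.2 y hy]
  exact CubeHEP.homotopicRel_of_homotopies A G' C hAC

end Transfer

end SeqTelescope

end Literature.AlgebraicTopology.Homotopy
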